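import Summits.BirchSwinnertonDyer.BirchSwinnertonDyer.Theorems.GenusKolyvaginAtTwoKramerParityReciprocity
import Literature.NumberTheory.EllipticCurves.PoonenRainsTateForm
import Literature.NumberTheory.EllipticCurves.PoonenRainsTwist
import HarnessLib

/-!
# Route `GenusKolyvaginAtTwo`, crux #2 `GenusPrimitiveSupplyAtTwo` (stmt-BirchSwinnertonDyer-22136):
# KRAMER'S PARITY THEOREM `MazurRubin2010.kramerParity K` HOLDS FOR EVERY NUMBER FIELD

Lead seat `bsd-line-gk2-p1` g10 (cell `bsd-f1-sign2`).  The named fact `MazurRubin2010.kramerParity` (Kramer 1981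
Thm. 1 = Mazur–Rubin 2010 Thm. 2.7: `dim Sel₂(E^F) − dim Sel₂(E) ≡ Σ_v dim H¹_𝓕/(H¹_𝓔 ∩ H¹_𝓕) (mod 2)`, in the
tree's `IsSquare`-spelling) is DISCHARGED by the Klagsbrun–Mazur–Rubin method with Poonen–Rains' Tate quadratic
forms, assembled from:

* the width seat's bridge `GenusKolyKramer.kramerParity_of_tateQuadraticForms_canonical` (gk2-p4 g11: KMR Thm. 3.9
  on `H¹(K, E[2])` with every Poitou–Tate input discharged, leaving a Poonen–Rains datum (e₂, q_v) with (Q1)–(Q4));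
* the lead's explicit construction `ThetaLevelTwo.prClass` (Heisenberg/theta cochains) and its properties:
  (Q1) `prForm_add` (polar form = Weil cup product), (Q2) `prForm_eq_zero_of_mem_kummer` (Poonen–Rains Prop. 4.8),
  (Q3) `tateQuadraticForm_prClass_Q3` (Brauer reciprocity, gk2-p4 g11), and — this file — (Q4) `prForm_twist_Q4`
  (KMR Lemma 5.2: `q_E ∘ H¹(f) = q_{E'}` for the twist identification `f : E'[2] ≅ E[2]`,
  `PoonenRainsTwist.prClass_map_twistTorsionMap`, plus (Q2) for `E'`).

* `prForm_twist_Q4` — hypothesis (Q4) of the bridge for `q = prForm W h2`;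
* **`kramerParity_holds`** — `MazurRubin2010.kramerParity K` for every number field `K`.

THEOREMS ONLY (no definition, no named fact, no `sorry`); helper `--supports stmt-BirchSwinnertonDyer-22136`; no item is
closed: the crux stays OPEN at (U) ∧ (CONV₂); BSD is not proved by any of this.

References: [Kramer1981] Thm. 1; [MazurRubin2010] Thm. 2.7; [KlagsbrunMazurRubin2013] Thm. 3.9, Lemma 5.2;
[PoonenRains2012] Cor. 4.6, Prop. 4.8, Thm. 4.14.
-/

set_option linter.dupNamespace false -- tree convention: `Summit.BirchSwinnertonDyer.BirchSwinnertonDyer.Theorems` (summit = sub-problem)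
set_option autoImplicit false

noncomputable section

open scoped Classical ContRepresentation

namespace Summit.BirchSwinnertonDyer.BirchSwinnertonDyer.Theorems.GenusKolyPR

open WeierstrassCurve Field NumberField
open Literature.NumberTheory.EllipticCurves Literature.NumberTheory.EllipticCurves.ThetaLevelTwo
open Literature.NumberTheory.GaloisRepresentations
open Literature.NumberTheory.GaloisRepresentations.DiscreteGaloisModule (SelmerStructure)
open Literature.NumberTheory.GaloisCohomology (LocalInvariants)
open Summit.BirchSwinnertonDyer.Rank1Residual.X11b.Relaxation
open Summit.BirchSwinnertonDyer.BirchSwinnertonDyer.Theorems.GenusKolyKramer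

variable {K : Type} [Field K] [NumberField K]

/-- **(Q4) for the Poonen–Rains form**: the Tate quadratic form `q_v = can_v ∘ q_{K_v}` of `W` kills the Kummer
condition of every quadratic twist `W' ≅ W^d` transported along the (unique) identification `φ : W'[2] ≅ W[2]`.
Proof: `φ` is the explicit twist identification `twistTorsionMap` (uniqueness clause), under which the Poonen–Rains
forms of `W` and `W'` agree (`prClass_map_twistTorsionMap`, KMR Lemma 5.2), and `q_{W'}` kills the Kummer classes of
`W'` ((Q2) `prForm_eq_zero_of_mem_kummer`). [cite: KlagsbrunMazurRubin2013, Lemma 5.2] [cite: PoonenRains2012, Prop. 4.8] -/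
theorem prForm_twist_Q4 (W : WeierstrassCurve K) [W.IsElliptic] (h2 : (2 : K) ≠ 0) (d : K) (hd : ∀ x : K, x ^ 2 ≠ d)
    (W' : WeierstrassCurve K) [W'.IsElliptic] (hC : ∃ C : VariableChange K, C • W' = W.quadraticTwist d)
    (φ : (W'.torsionGaloisModule ((2 : ℕ) : ℤ)).toContRepresentation →ⁱL
      (W.torsionGaloisModule ((2 : ℕ) : ℤ)).toContRepresentation)
    (_hφ : Function.Injective φ)
    (huniq : ∀ φ' : (W'.torsionGaloisModule ((2 : ℕ) : ℤ)).toContRepresentation →ⁱL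
        (W.torsionGaloisModule ((2 : ℕ) : ℤ)).toContRepresentation,
      Function.Injective φ' → ∀ a, φ' a = φ a)
    (𝓐 : SelmerStructure (W.torsionGaloisModule ((2 : ℕ) : ℤ)))
    (h𝓐 : ∀ v, 𝓐 v = (W'.kummerSelmerStructure ((2 : ℕ) : ℤ) v).map
      (galoisCohomology.map (φ.restrictField (Place.Completion v)) 1))
    (v : Place K) (x : galoisCohomology ((W.torsionGaloisModule ((2 : ℕ) : ℤ)).toLocal v) 1) (hx : x ∈ 𝓐 v) :
    prForm W h2 v x = 0 := by
  obtain ⟨C, hC⟩ := hC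
  -- the explicit identification, read at level `((2 : ℕ) : ℤ)`
  let f₀ : (W'.torsionGaloisModule ((2 : ℕ) : ℤ)).toContRepresentation →ⁱL
      (W.torsionGaloisModule ((2 : ℕ) : ℤ)).toContRepresentation := twistTorsionMap W W' h2 d C hC hd
  have hf₀ : Function.Injective f₀ := twistTorsionMap_injective W W' h2 d C hC hd
  have hφ : φ = f₀ :=
    ContIntertwiningMap.ext (ContinuousLinearMap.ext fun a => (huniq f₀ hf₀ a).symm)
  subst hφ
  rw [h𝓐 v] at hx
  obtain ⟨x', hx', rfl⟩ := AddSubgroup.mem_map.mp hx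
  have hQ2 := prForm_eq_zero_of_mem_kummer W' h2 v x' hx'
  have key := prClass_map_twistTorsionMap W W' h2 d C hC hd (Place.Completion v)
    (show galoisCohomology (GaloisRep.restrictField (Place.Completion v) (W'.torsionGaloisModule 2)) 1 from x')
  unfold prForm at hQ2 ⊢
  rw [← key] at hQ2
  exact hQ2

/-- **KRAMER'S PARITY THEOREM (Kramer 1981 Thm. 1; Mazur–Rubin 2010 Thm. 2.7) for every number field**, as the named
fact `MazurRubin2010.kramerParity K` of the tree — DISCHARGED by the Klagsbrun–Mazur–Rubin method (Thm. 3.9 on the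
Kummer quadratic Selmer structure of `E[2]`) with the EXPLICIT Poonen–Rains Tate quadratic forms of the lead's chain
(`prClass`; (Q1) `prForm_add`, (Q2) `prForm_eq_zero_of_mem_kummer`, (Q3) `tateQuadraticForm_prClass_Q3`,
(Q4) `prForm_twist_Q4`) fed into `kramerParity_of_prForm_twistInvariance` / `kramerParity_of_tateQuadraticForms_canonical`.
[cite: MazurRubin2010, Thm. 2.7] [cite: Kramer1981, Thm. 1] [cite: KlagsbrunMazurRubin2013, Thm. 3.9 and Lemma 5.2]
[cite: PoonenRains2012, Cor. 4.6, Prop. 4.8 and Thm. 4.14] -/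
theorem kramerParity_holds : MazurRubin2010.kramerParity K := by
  have h2 : (2 : K) ≠ 0 := two_ne_zero
  refine kramerParity_of_tateQuadraticForms_canonical fun W _ => ?_
  refine ⟨prWeilN W h2, prWeilN_sq W h2, prWeilN_add_left W h2, prWeilN_add_right W h2, smul_prWeilN W h2,
    prWeilN_self W h2, eq_zero_of_prWeilN_eq_one W h2, prForm W h2, ?_, ?_, ?_, ?_⟩
  · intro v x y
    rw [prForm_add, invWeilPairing_apply]
  · exact fun v x hx => prForm_eq_zero_of_mem_kummer W h2 v x hx
  · exact tateQuadraticForm_prClass_Q3 W h2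
  · intro d hd W' _ hC φ hφ huniq 𝓐 h𝓐 v x hx
    exact prForm_twist_Q4 W h2 d hd W' hC φ hφ huniq 𝓐 h𝓐 v x hx

end Summit.BirchSwinnertonDyer.BirchSwinnertonDyer.Theorems.GenusKolyPR

end
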